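import Mathlib
import HarnessLib
import Summits.ResolutionOfSingularities.ResolutionOfSingularities.Theorems.WildQuotientsWildQuotientResolutionS1aRingKillDataOfCert
import Summits.ResolutionOfSingularities.ResolutionOfSingularities.Theorems.WildQuotientsWildQuotientResolutionS1aVeroneseNormalisation

/-!
# S1a — A KILLED NODE STAYS KILLED: the Cartier centre `(s)` carries a cobordant kill certificate (`RingKillData` on the killed charts of a move)

[OURS · L1 W4.5c · lead-1 g10; FRAME-STATUS rev11 §4 item 3 «charts the second-level centre misses need a dummy Cartier centre»] — NOT statements of the
manuscript; counted 0; AI-level work, weaker than expert review. Crux stmt-ResolutionOfSingularities-17941 `CyclicQuotientFourfolds`, line `s1a-logminvertex`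
v10; the per-chart hypothesis `hdata` of `killableAt_over_of_ringKillData` (p628829) / `auxChartsAt_of_ringData` (p629686) on the charts of an aux move that
the second-level centre does NOT meet. Route-independent; pure algebra.

After a boundary-admissible move the augmentation ideal on a chart is `(β s)·𝔞` (`AuxResidual`, p637654); on a chart missing `V(𝔞)` it is `(β s)`: the node
is KILLED by the product boundary × exceptional. Such a node still has to present `RingKillData` (a centre with `0 < c`); the natural choice is the CARTIER
centre `(s)` (weight 1, boundary `β`): blowing up a Cartier divisor changes nothing, and the certificate is `β · s_new`.
* `weightedFiltration_singleton` — for `c = 1`, `w = 1`: `𝒥ₙ = (sⁿ)`;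
* ★★ `cobordantKillCert_cartier_of_killed` — `σ s = s`, `augIdeal σ ≤ (β s)` and `β s ∈ augIdeal σ` ⇒ `CobordantKillCert ![s] ![1] σ … (β · s_new)`
  ((a′): `σ(sⁿu) − sⁿu = sⁿ(σu − u) ∈ β sⁿ⁺¹`; (ii): `s·β ∈ augIdeal σ`; (i) with `N = 1` and no `⊔ (s_new)`: `sʼ · (β s_new) = β s ∈ augIdeal σ_R`);
* ★★ `ringKillData_of_killed` — in a node `(B, 𝒜, σ)`: `s, β` with `s` homogeneous, a regular element with `B ⧸ (s)` regular (the exceptional divisor of the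
  chart), `σ s = s`, `augIdeal σ = (β s)`-killed as above, (T2) ⇒ `RingKillData p r B 𝒜 σ`.
-/

set_option linter.dupNamespace false

noncomputable section

open Literature.AlgebraicGeometry.Resolution
open scoped LaurentPolynomial Pointwise
open Summit.ResolutionOfSingularities.ResolutionOfSingularities.Theorems.WildQuotientResolution.S1
open Summit.ResolutionOfSingularities.ResolutionOfSingularities.Theorems.WildQuotientResolution.S1.ProducerStep
open Summit.ResolutionOfSingularities.ResolutionOfSingularities.Theorems.WildQuotientResolution.S1.CoarseChart
open Summit.ResolutionOfSingularities.ResolutionOfSingularities.Theorems.WildQuotientResolution.S1.BlowupCharts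

namespace Summit.ResolutionOfSingularities.ResolutionOfSingularities.Theorems.WildQuotientResolution.S1.KillCert

universe u

section Cartier

variable {B : Type u} [CommRing B] (s : B) (σ : B ≃+* B) {p : ℕ} (hp : 0 < p) (hσp : ∀ x : B, (⇑σ)^[p] x = x)

/-- For the one-element centre `(s)` with weight `1`: `𝒥ₙ = (sⁿ)`. [folklore] -/
theorem weightedFiltration_singleton (n : ℕ) : (weightedFiltration ![s] ![1]).ideal n = Ideal.span {s ^ n} := by
  apply le_antisymm
  · rw [weightedFiltration_ideal, Ideal.span_le]
    rintro _ ⟨α, hα, rfl⟩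
    rw [Finsupp.weight_apply, Finsupp.sum_fintype _ _ (fun _ => by simp), Fin.sum_univ_one] at hα
    simp only [Matrix.cons_val_fin_one, smul_eq_mul, mul_one] at hα
    rw [SetLike.mem_coe, Finsupp.prod_fintype _ _ (fun _ => pow_zero _), Fin.prod_univ_one, Matrix.cons_val_fin_one]
    obtain ⟨k, hk⟩ := Nat.exists_eq_add_of_le hα
    rw [hk, pow_add]
    exact Ideal.mul_mem_right _ _ (Ideal.mem_span_singleton_self _)
  · rw [Ideal.span_singleton_le_iff_mem]
    have h1 : s ∈ (weightedFiltration ![s] ![1]).ideal 1 := mem_weightedFiltration_ideal ![s] ![1] 0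
    have h2 := Veronese.idealFiltration_pow_le (weightedFiltration ![s] ![1]) 1 n (Ideal.pow_mem_pow h1 n)
    rwa [one_mul] at h2

/-- (a′) for the Cartier centre `(s)` of a node killed by `β s`: `σ s = s` and `augIdeal σ ≤ (β s)` ⇒ `y ∈ (sⁿ) ⇒ σ y − y ∈ β (sⁿ⁺¹)`. [OURS · L1 W4.5c] -/
theorem admissible_cartier_of_killed (β : B) (hσs : σ s = s) (hle : augmentationIdeal σ ≤ Ideal.span {β * s}) (n : ℕ) (y : B)
    (hy : y ∈ (weightedFiltration ![s] ![1]).ideal n) :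
    σ y - y ∈ Ideal.span {β} * (weightedFiltration ![s] ![1]).ideal (n + 1) := by
  rw [weightedFiltration_singleton] at hy ⊢
  obtain ⟨u, rfl⟩ := Ideal.mem_span_singleton'.mp hy
  obtain ⟨a, ha⟩ := Ideal.mem_span_singleton'.mp (hle (sub_mem_augmentationIdeal σ u))
  have e : σ (u * s ^ n) - u * s ^ n = β * (a * s ^ (n + 1)) := by
    rw [map_mul, map_pow, hσs, ← sub_mul, ← ha]; ring
  rw [e]
  exact Ideal.mul_mem_mul (Ideal.mem_span_singleton_self β) (Ideal.mul_mem_left _ _ (Ideal.mem_span_singleton_self _))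

/-- ★★ **A KILLED NODE STAYS KILLED along the Cartier centre `(s)`.** If `σ s = s`, every increment is a multiple of `β s` and `β s` is itself in the
augmentation ideal (the node is killed by boundary × exceptional), then `β · s_new` is a cobordant kill certificate for the centre `(s)` with weight `1`
(`s_new = t⁻¹` the new exceptional coordinate; (i) holds with `N = 1`: `sʼ·(β s_new) = β s ∈ augIdeal σ_R`). [OURS · L1 W4.5c; NOT a statement of the manuscript] -/
theorem cobordantKillCert_cartier_of_killed (β : B) (hσs : σ s = s) (hle : augmentationIdeal σ ≤ Ideal.span {β * s})
    (hmem : β * s ∈ augmentationIdeal σ)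
    (hσJ : ∀ n : ℕ, ((weightedFiltration ![s] ![1]).ideal n).map (σ : B →+* B) ≤ (weightedFiltration ![s] ![1]).ideal n) :
    CobordantKillCert ![s] ![1] σ hσJ hp hσp (algebraMap B (↥(cobordantAlgebra ![s] ![1])) β * cobordantAlgebra.s ![s] ![1]) := by
  refine cobordantKillCert_of_admissible_of_irrelevant ![s] ![1] σ hσJ hp hσp β (admissible_cartier_of_killed s σ β hσs hle) ⟨1, ?_⟩ ⟨1, ?_⟩
  · -- (ii): `s · β ∈ augIdeal σ`
    rw [pow_one, Ideal.span_le]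
    rintro _ ⟨i, rfl⟩
    rw [SetLike.mem_coe, Ideal.mem_colon_span_singleton]
    fin_cases i
    simpa [mul_comm] using hmem
  · -- (i): `sʼ ∈ (augIdeal σ_R : β s_new)`
    rw [pow_one, cobordantAlgebra.vertexIdeal, Ideal.span_le]
    rintro _ ⟨i, rfl⟩
    refine Ideal.mem_sup_left ?_
    rw [Ideal.mem_colon_span_singleton]
    have e : cobordantAlgebra.u' ![s] ![1] i * (algebraMap B (↥(cobordantAlgebra ![s] ![1])) β * cobordantAlgebra.s ![s] ![1]) =
        algebraMap B (↥(cobordantAlgebra ![s] ![1])) (β * s) := by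
      have hu := cobordantAlgebra.algebraMap_u ![s] ![1] i
      fin_cases i
      simp only [Matrix.cons_val_fin_one, pow_one] at hu ⊢
      rw [map_mul, hu]; ring
    rw [e]
    exact OneShotKill.map_augmentationIdeal_le σ _ (sigmaR_algebraMap σ ![s] ![1] hσJ hp hσp) (Ideal.mem_map_of_mem _ hmem)

end Cartier

section Node

variable {p : ℕ} {m : ℕ} (r : Fin m → ℕ) (B : Type u) [CommRing B] (𝒜 : (Π j : Fin m, ZMod (r j)) → AddSubgroup B)
  [GradedRing 𝒜] (σ : B ≃+* B)

/-- ★★ **`RingKillData` ON A KILLED CHART via the Cartier centre `(s)`.** In a node `(B, 𝒜, σ)` with (T2), let `s ∈ 𝒜 δ₀` be a regular element with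
`B ⧸ (s)` regular (the exceptional divisor of the chart) and `σ s = s`, and `β` with `augIdeal σ ≤ (β s) ∋ β s` (the chart is killed by boundary ×
exceptional, e.g. by `AuxResidual` off `V(𝔞)`). Then `RingKillData p r B 𝒜 σ` — the `hdata` of `killableAt_over_of_ringKillData` on charts the second-level
centre misses. [OURS · L1 W4.5c; NOT a statement of the manuscript] -/
theorem ringKillData_of_killed (hT2 : ∃ t : Finset B, Subring.closure (((𝒜 0 : AddSubgroup B) : Set B) ∪ ↑t) = ⊤)
    (s β : B) {δ₀ : Π j : Fin m, ZMod (r j)} (hs : s ∈ 𝒜 δ₀) (hreg : IsSMulRegular B s) (hne : Ideal.span {s} ≠ ⊤)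
    (hquot : IsRegularRing (B ⧸ Ideal.span {s})) (hσs : σ s = s)
    (hle : augmentationIdeal σ ≤ Ideal.span {β * s}) (hmem : β * s ∈ augmentationIdeal σ) :
    RingKillData p r B 𝒜 σ := by
  classical
  have hrange : Set.range (![s] : Fin 1 → B) = {s} := by
    ext x
    simp only [Set.mem_range, Set.mem_singleton_iff]
    constructor
    · rintro ⟨i, rfl⟩; fin_cases i; rfl
    · rintro rfl; exact ⟨0, rfl⟩
  have hf : ∀ i : Fin 1, (![s] : Fin 1 → B) i ∈ 𝒜 ((fun _ => δ₀) i) := fun i => by fin_cases i; exact hs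
  obtain ⟨d, hver⟩ := Veronese.veroneseNormalisation _ _ 𝒜 hT2 1 ![s] (fun _ => δ₀) ![1] hf
  have hadm := admissible_cartier_of_killed s σ β hσs hle
  have hK1 : RingTheory.Sequence.IsRegular B (List.ofFn (![s] : Fin 1 → B)) := by
    have hl : List.ofFn (![s] : Fin 1 → B) = [s] := by simp [List.ofFn_succ]
    rw [hl, RingTheory.Sequence.isRegular_cons_iff]
    refine ⟨hreg, ?_⟩
    refine ⟨RingTheory.Sequence.IsWeaklyRegular.nil _ _, ?_⟩
    rw [Ideal.ofList_nil, Submodule.bot_smul]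
    intro htop
    -- `⊤ = ⊥` in `B ⧸ s•⊤` means `s•⊤ = ⊤`, i.e. `(s) = ⊤`
    apply hne
    rw [eq_top_iff]
    intro x _
    have hx : (Submodule.Quotient.mk x : QuotSMulTop s B) ∈ (⊥ : Submodule B (QuotSMulTop s B)) := by rw [← htop]; trivial
    rw [Submodule.mem_bot, Submodule.Quotient.mk_eq_zero] at hx
    obtain ⟨a, -, ha⟩ := (Submodule.mem_smul_pointwise_iff_exists _ _ _).mp hx
    rw [← ha, smul_eq_mul, mul_comm]
    exact Ideal.mul_mem_left _ _ (Ideal.mem_span_singleton_self _)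
  have hK1' : IsRegularRing (B ⧸ Ideal.span (Set.range (![s] : Fin 1 → B))) := by rw [hrange]; exact hquot
  exact ringKillData_of_cert r B 𝒜 σ ![s] (fun _ => δ₀) ![1] d Nat.one_pos hf (fun i => by fin_cases i; exact Nat.one_pos) hK1 hK1'
    (map_le_of_admissible ![s] ![1] σ β hadm) hver fun hp hσp =>
      ⟨_, cobordantKillCert_cartier_of_killed s σ hp hσp β hσs hle hmem (map_le_of_admissible ![s] ![1] σ β hadm)⟩

end Node

end Summit.ResolutionOfSingularities.ResolutionOfSingularities.Theorems.WildQuotientResolution.S1.KillCert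

end
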